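/-
Copyright (c) 2026 the pub-hodgecm-mathlib formalisation cell (harness21).  Prover seat hodgecm-mathlib-A-p06 (g28) — (U) road, U2 piece (P0) (owner A-p19 (g24)), 2026-09-01.
-/
import Literature.NumberTheory.Weil1964.UnitaryArchTopFormHaar      -- ★ (A-p19 g20) D-T3′: `archTopFormHaar`, `archTopFormHaar_restrict_window`, `window`, …
import HarnessLib

/-!
# The window identity of the top-form Haar measure of `U(J)(E ⊗ ℝ)` on ANY open neighbourhood of `0` inside the Cayley source with compact closure there
# ((U) road, U2 piece (P0) «moved window»; Helgason 2000 Ch. I §1 Thm. 1.14; Rogawski 1990 §1.7)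

Topic `NumberTheory/Weil1964`, namespace `Literature.NumberTheory.Weil1964.UnitaryArchTopForm` (★ D-T3′'s).  THEOREMS ONLY: no definition, no named fact, no instance, no
notation, no `sorry`; kernel lane.  Cell `pub/hodgecm-mathlib`, crux H413 = `stmt-HodgeConjecture-24833` (supports only); (U) road (LEAD T9-32 (4)∕T9-34 (2); owner A-p19 (g24),
card `A-provers/A-p19/g24/ROAD-U-v1.A-p19g24.md`), brick U2 «product theorem» = `(archPiEquivCM)_* archTopFormHaar = Measure.pi archLocalTopFormHaar`, piece (P0).
HONEST LABEL: HC_CM is proved only modulo the 2 remaining named inputs (hLiu418 24832, h413 24833) until rung 0 closes; nothing printed is discharged here.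

WHAT.  ★ `archTopFormHaar_restrict_window` pins the top-form Haar measure on the chart image of ONE ball `W` (the window of record):
`(archTopFormHaar J)|_{ĉ(W)} = ĉ_*(w₀ · λ|_W)`.  The product theorem compares it with `Measure.pi` of the per-place measures on the image of a PRODUCT of per-place windows,
whose preimage `V₀ ⊆ 𝔲(J)` is open, contains `0`, lies in a compact subset of the chart source — but is not the ball `W`.  THIS FILE moves the identity to every such `V₀`:
**`archTopFormHaar_restrict_image_of_isOpen (hnd) (hV₀o) (h0) (hK) (hKs) (hV₀K) : (archTopFormHaar J)|_{ĉ(V₀)} = ĉ_*(w₀ · λ|_{V₀})`**.  PROOF: the chart measure `ν_{V₀}`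
is locally left-invariant on `ĉ(V₀)` (★ B5b `cayleyChartMeasure_preimage_mul`, stated for every `V₀ ⊆ source`), so ★ `HaarLocalChartLeft.eq_smul_restrict_of_locallyInvariant_of_isOpen`
gives `ν_{V₀} = κ • haar|_{ĉ(V₀)}`; the top-form measure is `c • haar` (`archTopFormHaar_def`); and `κ = c` by evaluating both on `ĉ(V₀ ∩ W)`, where `ν_{V₀}` and `ν_W` agree
(`= ∫_{V₀ ∩ W} w₀ dλ`, injectivity of `ĉ` on the source) and `ν_W = (archTopFormHaar)|_{ĉ(W)}` (★ window identity).

## References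
* S. Helgason, *Groups and Geometric Analysis*, AMS Math. Surveys Monogr. 83 (2000), Ch. I §1 Thm. 1.14 p. 96. [Helgason2000]
* J. D. Rogawski, *Automorphic Representations of Unitary Groups in Three Variables*, Ann. of Math. Stud. 123 (1990), §1.7 p. 6. [Rogawski1990]
-/

set_option autoImplicit false
-- the scoped normed structure on the submodule `𝔲 ≤ M_N(E ⊗ ℝ)` is only reducibly defeq to the subtype uniformity ∕ topology carried by the
-- `[BorelSpace ↥(archSkew …)]` binder (as in ★ `Weil1964/UnitaryArchTopFormHaar`)
set_option backward.isDefEq.respectTransparency false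

noncomputable section

open NumberField NumberField.mixedEmbedding Set Filter Topology MeasureTheory MeasureTheory.Measure
open Literature.NumberTheory.Automorphic Literature.NumberTheory.Automorphic.UnitaryGroup
open scoped Classical Matrix Matrix.Norms.Operator MatrixGroups ENNReal NNReal Pointwise

namespace Literature.NumberTheory.Weil1964

namespace UnitaryArchTopForm

variable (F E : Type) [Field F] [Field E] [NumberField E] [Algebra F E] (c : E ≃ₐ[F] E) (N : ℕ) (J : Matrix (Fin N) (Fin N) E)

variable {F E c N}

variable [MeasurableSpace (archSkew F E c N J)] [BorelSpace (archSkew F E c N J)] [MeasurableSpace (arch F E c N J)] [BorelSpace (arch F E c N J)]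

omit [MeasurableSpace (archSkew F E c N J)] [BorelSpace (archSkew F E c N J)] [MeasurableSpace (arch F E c N J)] [BorelSpace (arch F E c N J)] in
/-- The chart image of a subset of a compact subset of the source is relatively compact. [cite: Helgason2000, Ch. I §1 Thm. 1.14 p. 96] -/
theorem isCompact_closure_image_cayleyChart {V₀ K : Set (archSkew F E c N J)} (hK : IsCompact K) (hKs : K ⊆ cayleySource F E c N J) (hV₀K : V₀ ⊆ K) :
    IsCompact (closure (cayleyChart F E c N J '' V₀)) :=
  (hK.image_of_continuousOn ((continuousOn_cayleyChart J).mono hKs)).closure_of_subset (Set.image_mono hV₀K)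

/-- On the chart image of `V₀ ∩ V₁` (`V₀, V₁ ⊆ source` open) the chart measures with windows `V₀` and `V₁` agree: both are `∫_{V₀ ∩ V₁} w₀ dλ` on every measurable subset
(injectivity of `ĉ` on the source). [cite: Helgason2000, Ch. I §1 Thm. 1.14 (13) p. 96] -/
theorem cayleyChartMeasure_restrict_image_inter (lam : Measure (archSkew F E c N J)) {V₀ V₁ : Set (archSkew F E c N J)}
    (hV₀o : IsOpen V₀) (hV₀s : V₀ ⊆ cayleySource F E c N J) (hV₁o : IsOpen V₁) (hV₁s : V₁ ⊆ cayleySource F E c N J) :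
    (cayleyChartMeasure F E c N J lam V₀).restrict (cayleyChart F E c N J '' (V₀ ∩ V₁)) =
      (cayleyChartMeasure F E c N J lam V₁).restrict (cayleyChart F E c N J '' (V₀ ∩ V₁)) := by
  have hIo : IsOpen (cayleyChart F E c N J '' (V₀ ∩ V₁)) := isOpen_image_cayleyChart J (Set.inter_subset_left.trans hV₀s) (hV₀o.inter hV₁o)
  refine Measure.ext fun S hS => ?_
  rw [Measure.restrict_apply hS, Measure.restrict_apply hS, cayleyChartMeasure_apply J lam V₀ (hS.inter hIo.measurableSet),
    cayleyChartMeasure_apply J lam V₁ (hS.inter hIo.measurableSet)]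
  -- both integration domains are `ĉ⁻¹ S ∩ (V₀ ∩ V₁)`
  have key : ∀ {A B : Set (archSkew F E c N J)}, A ⊆ cayleySource F E c N J → B ⊆ cayleySource F E c N J →
      cayleyChart F E c N J ⁻¹' (S ∩ cayleyChart F E c N J '' (A ∩ B)) ∩ A = cayleyChart F E c N J ⁻¹' S ∩ (A ∩ B) := by
    intro A B hA hB
    ext X
    constructor
    · rintro ⟨⟨hXS, ⟨Y, hY, hYX⟩⟩, hXA⟩
      have hXY : Y = X := injOn_cayleyChart J (hA hY.1) (hA hXA) hYX
      subst hXY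
      exact ⟨hXS, hY⟩
    · rintro ⟨hXS, hXAB⟩
      exact ⟨⟨hXS, ⟨X, hXAB, rfl⟩⟩, hXAB.1⟩
  rw [key hV₀s hV₁s, Set.inter_comm V₀ V₁, key hV₁s hV₀s, Set.inter_comm V₁ V₀]

/-- **THE WINDOW IDENTITY ON ANY ADMISSIBLE OPEN SET**: for `V₀ ⊆ 𝔲(J)` open, `0 ∈ V₀`, `V₀ ⊆ K ⊆ source` with `K` compact,
`(archTopFormHaar J)|_{ĉ(V₀)} = ĉ_*(w₀ · lieStdLebesgue J|_{V₀})` (the ★ window identity moved from the ball of record to `V₀`).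
[cite: Helgason2000, Ch. I §1 Thm. 1.14 (13) p. 96] [cite: Rogawski1990, §1.7 p. 6] -/
theorem archTopFormHaar_restrict_image_of_isOpen (hnd : lieGramDet F E c N J ≠ 0) {V₀ K : Set (archSkew F E c N J)}
    (hV₀o : IsOpen V₀) (h0 : (0 : archSkew F E c N J) ∈ V₀) (hK : IsCompact K) (hKs : K ⊆ cayleySource F E c N J) (hV₀K : V₀ ⊆ K) :
    (archTopFormHaar F E c N J).restrict (cayleyChart F E c N J '' V₀) = cayleyChartMeasure F E c N J (lieStdLebesgue F E c N J) V₀ := by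
  haveI := isAddHaarMeasure_lieStdLebesgue J hnd
  haveI : SFinite (lieStdLebesgue F E c N J) := by rw [lieStdLebesgue_def]; infer_instance
  haveI := isHaarMeasure_archTopFormHaar J hnd
  have hV₀s : V₀ ⊆ cayleySource F E c N J := hV₀K.trans hKs
  set lam := lieStdLebesgue F E c N J with hlam
  set ν := cayleyChartMeasure F E c N J lam V₀ with hν
  haveI : SFinite ν := by rw [hν, cayleyChartMeasure]; infer_instance
  have hU₀o : IsOpen (cayleyChart F E c N J '' V₀) := isOpen_image_cayleyChart J hV₀s hV₀o
  have hU₀ne : (cayleyChart F E c N J '' V₀).Nonempty := ⟨_, ⟨0, h0, rfl⟩⟩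
  have hU₀c : IsCompact (closure (cayleyChart F E c N J '' V₀)) := isCompact_closure_image_cayleyChart J hK hKs hV₀K
  have hνU : ν (cayleyChart F E c N J '' V₀)ᶜ = 0 := cayleyChartMeasure_compl_image J _ hV₀s hV₀o
  have hloc : ∀ (g : arch F E c N J) (B : Set (arch F E c N J)), MeasurableSet B → B ⊆ cayleyChart F E c N J '' V₀ →
      (fun x => g * x) ⁻¹' B ⊆ cayleyChart F E c N J '' V₀ → ν ((fun x => g * x) ⁻¹' B) = ν B :=
    fun g B hB hBU hgB => cayleyChartMeasure_preimage_mul J _ hV₀o.measurableSet hV₀s g hB hBU hgB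
  -- the averaging lemma on `ĉ(V₀)`: `ν = κ • haar|_{ĉ(V₀)}`
  obtain ⟨κ, hκ⟩ : ∃ κ : ℝ≥0∞, ν = κ • (Measure.haar : Measure (arch F E c N J)).restrict (cayleyChart F E c N J '' V₀) :=
    ⟨_, Literature.MeasureTheory.Group.HaarLocalChartLeft.eq_smul_restrict_of_locallyInvariant_of_isOpen (μ := Measure.haar) (ν := ν) hU₀o hU₀ne hU₀c hνU hloc⟩
  -- the top-form measure is `cst • haar`
  have htop := archTopFormHaar_def (F := F) (E := E) (c := c) (N := N) J
  set cst := cayleyChartMeasure F E c N J (lieStdLebesgue F E c N J) (window F E c N J) (cayleyChart F E c N J '' window F E c N J) /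
      Measure.haar (cayleyChart F E c N J '' window F E c N J) with hcst
  -- evaluate on `I = ĉ(V₀ ∩ W)`: `ν I = archTopFormHaar I`
  have hIo : IsOpen (cayleyChart F E c N J '' (V₀ ∩ window F E c N J)) :=
    isOpen_image_cayleyChart J (Set.inter_subset_left.trans hV₀s) (hV₀o.inter (isOpen_window J))
  have hIU : cayleyChart F E c N J '' (V₀ ∩ window F E c N J) ⊆ cayleyChart F E c N J '' V₀ := Set.image_mono Set.inter_subset_left
  have hIW : cayleyChart F E c N J '' (V₀ ∩ window F E c N J) ⊆ cayleyChart F E c N J '' window F E c N J := Set.image_mono Set.inter_subset_right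
  have hνI : ν (cayleyChart F E c N J '' (V₀ ∩ window F E c N J)) = archTopFormHaar F E c N J (cayleyChart F E c N J '' (V₀ ∩ window F E c N J)) := by
    have h := congrArg (fun m : Measure (arch F E c N J) => m (cayleyChart F E c N J '' (V₀ ∩ window F E c N J)))
      (cayleyChartMeasure_restrict_image_inter J lam hV₀o hV₀s (isOpen_window J) (window_subset_cayleySource J))
    simp only [Measure.restrict_apply_self] at h
    rw [h, hlam, ← archTopFormHaar_restrict_window J hnd, Measure.restrict_apply hIo.measurableSet, Set.inter_eq_left.2 hIW]
  -- hence `κ = cst`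
  have hI0 : Measure.haar (cayleyChart F E c N J '' (V₀ ∩ window F E c N J)) ≠ 0 :=
    (hIo.measure_pos Measure.haar ⟨_, ⟨0, ⟨h0, zero_mem_window J⟩, rfl⟩⟩).ne'
  have hItop : Measure.haar (cayleyChart F E c N J '' (V₀ ∩ window F E c N J)) ≠ ⊤ :=
    ((measure_mono (hIU.trans subset_closure)).trans_lt hU₀c.measure_lt_top).ne
  have h1 : ν (cayleyChart F E c N J '' (V₀ ∩ window F E c N J)) = κ * Measure.haar (cayleyChart F E c N J '' (V₀ ∩ window F E c N J)) := by
    have := congrArg (fun m : Measure (arch F E c N J) => m (cayleyChart F E c N J '' (V₀ ∩ window F E c N J))) hκ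
    simpa only [Measure.smul_apply, smul_eq_mul, Measure.restrict_apply hIo.measurableSet, Set.inter_eq_left.2 hIU] using this
  have h2 : archTopFormHaar F E c N J (cayleyChart F E c N J '' (V₀ ∩ window F E c N J)) = cst * Measure.haar (cayleyChart F E c N J '' (V₀ ∩ window F E c N J)) := by
    rw [htop, Measure.smul_apply, smul_eq_mul]
  have hκc : κ = cst := by
    have h3 : κ * Measure.haar (cayleyChart F E c N J '' (V₀ ∩ window F E c N J)) = cst * Measure.haar (cayleyChart F E c N J '' (V₀ ∩ window F E c N J)) := by
      rw [← h1, ← h2, hνI]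
    exact (ENNReal.mul_left_inj hI0 hItop).1 h3
  rw [htop, Measure.restrict_smul, ← hκc, ← hκ]

end UnitaryArchTopForm

end Literature.NumberTheory.Weil1964

end
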